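import Summits.QuantumFields.BalabanUV.T4Continuum.Support.VariationalVectorEndOfLeaves
import Summits.QuantumFields.BalabanUV.T4Continuum.Support.VariationalVectorGarding

/-!
# T⁴ programme, spine node NE2 (U1a), lane P2 — THE LANDAU GAUGE FUNCTIONAL MEETS THE VECTOR END's THREE STRUCTURAL BINDERS:
# matrix form (`Gm` PSD, `G = qform Gm ∘ unc`) and COMP-compatibility along `sites` (`G_{k+1} = Gtr G′_k`)
# (`t4/skeletons/NE2-t4-ne2-p2.md` v0.15 §2.E rows V-GF ∕ «⟹ V-END»; model level; cell `pub-balaban`)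

NE2 formalisation swarm `b2b-balaban-t4-ne2-formalise-*`, leaf prover 10 GEN 3 (`prover-b2b-balaban-t4-ne2-formalise-leaf-10-g3-0`, lineage V-COMP TOWER);
journal INTENT CLAIMS.log 2026-08-20 14:12Z (leaf-09-g6's INFO-2 on `VariationalVectorTower`: «`hGtr` for a `divSq`-based functional needs `divSq` to transport
along `sites` like `roughV_transport`»).  On top of `VariationalVectorEndOfLeaves.towerLimitRate_effV_of_leaves` (p220074), `VariationalVectorGarding.landauG`
(p219068, leaf-09-g6: `landauG N δ R W = δ⁻¹·divSq N R W`), `VariationalVectorWeitzenbock.{divV, divSq}` (p218860), `VariationalVectorTower.{Gtr, comp_symm_comp}`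
(p218948) and `VariationalVectorEffective.{unc, cur, QmL-side matrices}` (p216485) — BY NAME; data defs `divLin`∕`divM`∕`Kdiv`∕`KLandau` in the
`curlLin`∕`curlM`∕`Kcurl` pattern, nothing else defined.

THE POINT.  `towerLimitRate_effV_of_leaves` has, besides the five displayed leaf families, three STRUCTURAL binders on the gauge ∕ curvature functional:
`Gm k` PSD, `G k = qform (Gm k) ∘ unc` (so that the effective operator `effV` exists as a Hermitian matrix), and the COMP identity `G (k+1) = Gtr (G′ k)`
(level `k+1`'s functional is the one-step functional read through `sites`).  For the tree's only inhabitant, the LANDAU family `landauG δ R = δ⁻¹·Σ_x‖div_R W(x)‖²`: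
 * §1 (`E = ℂ`) `divLin`∕`divM` (the covariant divergence as a linear map ∕ matrix on the product index), `divM_mulVec`, `Kdiv := divMᴴ·divM` (PSD),
   `form_Kdiv`, **`qform_Kdiv : qform (Kdiv N R) w = divSq N R (cur w)`**, `KLandau δ R := (δ⁻¹ : ℂ) • Kdiv`, `KLandau_posSemidef` (`0 ≤ δ`),
   **`landauG_eq_qform : landauG N δ R W = qform (KLandau N δ R) (unc W)`** — the `hGm`∕`hG` binders;
 * §2 (any Hilbert `E`) `sites_sub`, `DirAdjv_transport`, `divV_transport`, **`divSq_transport : divSq (fine (n·L) M) (Rtrv R′) (W′ ∘ sites) = divSq (fine L (fine n M)) R′ W′`**,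
   **`landauG_transport : Gtr n L M (landauG _ δ R′) = landauG _ δ (Rtrv n L M R′)`** and along a tower with `R (k+1) = Rtrv (R′ k)` the COMP identity
   **`landauG_hGtr : landauG δ (R (k+1)) = Gtr (L^k) L M (landauG δ (R′ k))`** — the `hGtr` binder;
 * §3 **`towerLimitRate_effV_of_leaves_landau`** = p220074's END with `Gm k := KLandau δ (R k)`, `G k := landauG δ (R k)`, `G′ k := landauG δ (R′ k)`: the three
   structural binders DISCHARGED; remaining binders = `hTcomp`∕`hRtr`, one-step `QvL (T′ k)` onto, `0 < a`, `0 < δ`, the five leaf families displayed WITH THESE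
   functionals, uniform level constants and the geometric decay of `δF`∕`ε₁`∕`δ′`.
HONEST, UP FRONT: this does NOT make the Landau functional the right `G` for the vector END — NOTE N-ne2leaf01g6-1 (CLAIMS.log, V-ONE-1F file 5 p219670) and
p219068's located remark record that the one-step consistency (GF2)∕(GF2′) is NOT expected for `landauG` with the tilted competitor ∕ under the line average, so the
`hONE`∕`hFED` sockets of §3 are NOT served by `VariationalVectorOneStepPhys.blockSpin_Q1_le` ∕ `VariationalVectorFederbushPhys.ScV_QvL_le_curl` (those are the
`G′ = 0` curl halves); leaf-09-g6's design note (CLAIMS.log 14:00Z, «V-GF REFRAMED = THE GAUGE-SLICE LOWER BRACKET», (iii)) records that at `U = 1`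
Bałaban's functional `‖(I − P)∂*A‖²` ([B5] (1.69)–(1.70)) meets the gauge-SLICE condition with `σ = 0` while the Landau functional `δ⁻¹·divSq` does NOT.  What is
settled here is only that the STRUCTURAL side — Hermitian matrix form and COMP-compatibility — is no obstruction for a `divSq`-type local quadratic functional,
and the reusable plumbing (`divM`, `Kdiv`, `divSq_transport`) is what a projected functional `‖(I − P_U) div_R W‖²` will need as well.  V-GF (the choice of `G`:
now (SLICE) + a covariant `P_U`) stays OPEN.

HONEST FRAMING (T4-DAG p. 1).  Model level; transports DATA (no identification with Bałaban's `U(Γ)`, `R = I − P` gauge term or minimisers — c5); [folklore] linear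
algebra + transport along `sites`; nothing printed is a hypothesis; data defs `divLin`∕`divM`∕`Kdiv`∕`KLandau` only, no `def … : Prop`, no `sorry`; axioms standard.
V-GF OPEN; V-END NOT proved; NE2 NOT proved; spine PROVED 0∕9 unchanged; rung (B)+1 finite T⁴ — NOT infinite volume, NOT mass gap, NOT Clay.  HONEST DEPENDENCY
(cell, verbatim): continuum YM on T⁴ ⇐ BetaPertH ∧ nine spine estimates (0/9 proved); BetaPertH ⇐ (D1) ∧ (D4) ∧ CAP+tail; G-an2-4 gates asym, D1 and NE2/3/4.
-/

noncomputable section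

namespace Summit.QuantumFields.BalabanUV.T4Continuum.VariationalVectorLandauTower

open Finset
open scoped Matrix ComplexConjugate ComplexOrder Matrix.Norms.L2Operator BigOperators
open Literature.MathematicalPhysics.QuantumFieldTheory.Balaban1983to89.B5Prop11Plancherel (Tor fine unitVec)
open Literature.MathematicalPhysics.QuantumFieldTheory.Balaban1983to89.B5Prop11Lower (nsq star_dotProduct_self)
open Literature.MathematicalPhysics.QuantumFieldTheory.Balaban1983to89.B5Composition116 (sites)
open Literature.Analysis.Complex (qform qform_smul)
open Summit.QuantumFields.BalabanUV.T4Continuum.VariationalTransfer (blockSpin)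
open Summit.QuantumFields.BalabanUV.T4Continuum.VariationalTower (sites_unitVec)
open Summit.QuantumFields.BalabanUV.T4Continuum.VariationalCovariantTower (sites_add)
open Summit.QuantumFields.BalabanUV.T4Continuum.VariationalColourTower (Rtrv)
open Summit.QuantumFields.BalabanUV.T4Continuum.BalabanAveragedCoerciveFibre (star_dotProduct_conjTranspose_mulVec)
open Summit.QuantumFields.BalabanUV.T4Continuum.CovariantAveragingTower (TowerLimitRate)
open Summit.QuantumFields.BalabanUV.T4Continuum.VariationalColourBochner (DirAdjv)
open Summit.QuantumFields.BalabanUV.T4Continuum.VectorBlockTrialForm (nsqV QvL compL)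
open Summit.QuantumFields.BalabanUV.T4Continuum.VariationalVectorForm (ScV SfV qWV qVV)
open Summit.QuantumFields.BalabanUV.T4Continuum.VariationalVectorEffective (unc cur cur_unc effV)
open Summit.QuantumFields.BalabanUV.T4Continuum.VariationalVectorWeitzenbock (divV divSq)
open Summit.QuantumFields.BalabanUV.T4Continuum.VariationalVectorGarding (landauG)
open Summit.QuantumFields.BalabanUV.T4Continuum.VariationalVectorTower (Gtr comp_symm_comp QmL)
open Summit.QuantumFields.BalabanUV.T4Continuum.VariationalVectorEndOfLeaves (eV ePV towerLimitRate_effV_of_leaves)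

variable {d : ℕ}

/-! ## §1 The Landau functional as the form of a PSD matrix (`E = ℂ`): the `hGm` ∕ `hG` binders -/

section MatrixForm

variable (N : Fin d → ℕ) [∀ μ, NeZero (N μ)]

/-- the covariant divergence `div_R` as a ℂ-linear map `(Tor N × Fin d → ℂ) → (Tor N → ℂ)` (`divV` on the curried field). [folklore] -/
def divLin (R : Tor N → Fin d → (ℂ →L[ℂ] ℂ)) : (Tor N × Fin d → ℂ) →ₗ[ℂ] (Tor N → ℂ) where
  toFun w x := divV N R (cur w) x
  map_add' w w' := by
    funext x
    simp only [divV, DirAdjv, cur, Pi.add_apply, map_add, ← Finset.sum_add_distrib]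
    exact Finset.sum_congr rfl fun μ _ => by ring
  map_smul' c w := by
    have h : ∀ (f : ℂ →L[ℂ] ℂ) (v : ℂ), f (c * v) = c * f v := fun f v => by rw [← smul_eq_mul, map_smul, smul_eq_mul]
    funext x
    simp only [divV, DirAdjv, cur, Pi.smul_apply, smul_eq_mul, RingHom.id_apply, h, Finset.mul_sum]
    exact Finset.sum_congr rfl fun μ _ => by ring

/-- the divergence matrix. [folklore] -/
def divM (R : Tor N → Fin d → (ℂ →L[ℂ] ℂ)) : Matrix (Tor N) (Tor N × Fin d) ℂ := LinearMap.toMatrix' (divLin N R)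

/-- the divergence matrix acts as the divergence. [folklore] -/
theorem divM_mulVec (R : Tor N → Fin d → (ℂ →L[ℂ] ℂ)) (w : Tor N × Fin d → ℂ) (x : Tor N) :
    (divM N R *ᵥ w) x = divV N R (cur w) x := by
  rw [divM, LinearMap.toMatrix'_mulVec]; rfl

/-- the matrix of the divergence form `Kdiv := divMᴴ·divM`. [folklore] -/
def Kdiv (R : Tor N → Fin d → (ℂ →L[ℂ] ℂ)) : Matrix (Tor N × Fin d) (Tor N × Fin d) ℂ := (divM N R)ᴴ * divM N R

/-- `Kdiv` is positive semidefinite. [folklore] -/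
theorem Kdiv_posSemidef (R : Tor N → Fin d → (ℂ →L[ℂ] ℂ)) : (Kdiv N R).PosSemidef := Matrix.posSemidef_conjTranspose_mul_self _

/-- the form of `Kdiv` is the divergence form: `w† Kdiv w = divSq (cur w)`. [folklore] -/
theorem form_Kdiv (R : Tor N → Fin d → (ℂ →L[ℂ] ℂ)) (w : Tor N × Fin d → ℂ) :
    star w ⬝ᵥ (Kdiv N R *ᵥ w) = ((divSq N R (cur w) : ℝ) : ℂ) := by
  rw [Kdiv, ← Matrix.mulVec_mulVec, star_dotProduct_conjTranspose_mulVec, star_dotProduct_self, nsq, divSq]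
  congr 1
  exact Finset.sum_congr rfl fun x _ => by rw [divM_mulVec]

/-- `qform Kdiv w = divSq (cur w)`. [folklore] -/
theorem qform_Kdiv (R : Tor N → Fin d → (ℂ →L[ℂ] ℂ)) (w : Tor N × Fin d → ℂ) : qform (Kdiv N R) w = divSq N R (cur w) := by
  rw [qform, form_Kdiv, Complex.ofReal_re]

/-- **the matrix of the Landau functional** `KLandau δ R := δ⁻¹ • Kdiv R`. [folklore] -/
def KLandau (δ : ℝ) (R : Tor N → Fin d → (ℂ →L[ℂ] ℂ)) : Matrix (Tor N × Fin d) (Tor N × Fin d) ℂ := (((δ⁻¹ : ℝ)) : ℂ) • Kdiv N R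

/-- `KLandau δ R` is positive semidefinite for `0 ≤ δ` — the `hGm` binder of `towerLimitRate_effV_of_leaves` for the Landau family. [folklore] -/
theorem KLandau_posSemidef {δ : ℝ} (hδ : 0 ≤ δ) (R : Tor N → Fin d → (ℂ →L[ℂ] ℂ)) : (KLandau N δ R).PosSemidef := by
  unfold KLandau
  exact Matrix.PosSemidef.smul (Kdiv_posSemidef N R) (Complex.zero_le_real.mpr (inv_nonneg.mpr hδ))

/-- **`landauG = qform KLandau ∘ unc`** — the `hG` binder of `towerLimitRate_effV_of_leaves` for the Landau family. [folklore] -/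
theorem landauG_eq_qform (δ : ℝ) (R : Tor N → Fin d → (ℂ →L[ℂ] ℂ)) (W : Tor N → Fin d → ℂ) :
    landauG N δ R W = qform (KLandau N δ R) (unc W) := by
  rw [KLandau, qform_smul, qform_Kdiv, cur_unc, landauG]

end MatrixForm

/-! ## §2 Transport of the divergence along `sites`: the `hGtr` binder (COMP-compatibility) for the Landau family -/

section Transport

variable {E : Type*} [NormedAddCommGroup E] [InnerProductSpace ℂ E] [CompleteSpace E]
variable (n L : ℕ) [NeZero n] [NeZero L] (M : Fin d → ℕ) [hM : ∀ μ, NeZero (M μ)]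

omit [NeZero n] [NeZero L] hM in
/-- `sites` respects differences. [folklore] -/
theorem sites_sub (x y : Tor (fine (n * L) M)) : sites n L M (x - y) = sites n L M x - sites n L M y :=
  eq_sub_of_add_eq (by rw [← sites_add, sub_add_cancel])

omit [NeZero n] [NeZero L] hM in
/-- the formal adjoint difference is transported: `D†_{n·L}(R′∘sites)(g′∘sites)(x) = D†(R′)(g′)(sites x)`. [folklore] -/
theorem DirAdjv_transport (R' : Tor (fine L (fine n M)) → Fin d → (E →L[ℂ] E)) (g' : Tor (fine L (fine n M)) → E) (μ : Fin d)
    (x : Tor (fine (n * L) M)) :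
    DirAdjv (fine (n * L) M) (Rtrv n L M R') μ (g' ∘ sites n L M) x = DirAdjv (fine L (fine n M)) R' μ g' (sites n L M x) := by
  simp only [DirAdjv, Rtrv, Function.comp_apply, sites_sub, sites_unitVec]

omit [NeZero n] [NeZero L] hM in
/-- the covariant divergence is transported pointwise. [folklore] -/
theorem divV_transport (R' : Tor (fine L (fine n M)) → Fin d → (E →L[ℂ] E)) (W' : Tor (fine L (fine n M)) → Fin d → E) (x : Tor (fine (n * L) M)) :
    divV (fine (n * L) M) (Rtrv n L M R') (W' ∘ sites n L M) x = divV (fine L (fine n M)) R' W' (sites n L M x) := by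
  unfold divV
  exact Finset.sum_congr rfl fun μ _ => DirAdjv_transport n L M R' (fun y => W' y μ) μ x

/-- **the divergence form is transported**: `divSq_{n·L}(R′∘sites)(W′∘sites) = divSq(R′)(W′)`. [folklore] -/
theorem divSq_transport (R' : Tor (fine L (fine n M)) → Fin d → (E →L[ℂ] E)) (W' : Tor (fine L (fine n M)) → Fin d → E) :
    divSq (fine (n * L) M) (Rtrv n L M R') (W' ∘ sites n L M) = divSq (fine L (fine n M)) R' W' := by
  unfold divSq
  calc ∑ x, ‖divV (fine (n * L) M) (Rtrv n L M R') (W' ∘ sites n L M) x‖ ^ 2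
      = ∑ x, ‖divV (fine L (fine n M)) R' W' (sites n L M x)‖ ^ 2 := Finset.sum_congr rfl fun x _ => by rw [divV_transport]
    _ = ∑ y, ‖divV (fine L (fine n M)) R' W' y‖ ^ 2 := Equiv.sum_comp (sites n L M) (fun y => ‖divV (fine L (fine n M)) R' W' y‖ ^ 2)

/-- **the Landau functional is COMP-compatible**: reading the one-step Landau functional through `sites` gives the Landau functional of the transported
bond operators, `Gtr n L M (landauG δ R′) = landauG δ (Rtrv R′)`. [folklore] -/
theorem landauG_transport (δ : ℝ) (R' : Tor (fine L (fine n M)) → Fin d → (E →L[ℂ] E)) :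
    Gtr n L M (landauG (fine L (fine n M)) δ R') = landauG (fine (n * L) M) δ (Rtrv n L M R') := by
  funext W
  unfold Gtr landauG
  conv_rhs => rw [← comp_symm_comp n L M W]
  rw [divSq_transport]

variable (R : (k : ℕ) → Tor (fine (L ^ k) M) → Fin d → (E →L[ℂ] E)) (R' : (k : ℕ) → Tor (fine L (fine (L ^ k) M)) → Fin d → (E →L[ℂ] E))

omit [NeZero n] in
/-- **the `hGtr` binder for the Landau family along a tower**: `R (k+1) = Rtrv (R′ k)` ⟹ `landauG δ (R (k+1)) = Gtr (L^k) L M (landauG δ (R′ k))`. [folklore] -/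
theorem landauG_hGtr (hRtr : ∀ k, R (k + 1) = Rtrv (L ^ k) L M (R' k)) (δ : ℝ) (k : ℕ) :
    landauG (fine (L ^ (k + 1)) M) δ (R (k + 1)) = Gtr (L ^ k) L M (landauG (fine L (fine (L ^ k) M)) δ (R' k)) := by
  rw [landauG_transport, hRtr k]; rfl

end Transport

/-! ## §3 The vector END modulo the leaves, Landau family: the three structural binders discharged -/

section Tower

variable (L : ℕ) [NeZero L] (M : Fin d → ℕ) [hM : ∀ μ, NeZero (M μ)]
variable (R : (k : ℕ) → Tor (fine (L ^ k) M) → Fin d → (ℂ →L[ℂ] ℂ))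
variable (R' : (k : ℕ) → Tor (fine L (fine (L ^ k) M)) → Fin d → (ℂ →L[ℂ] ℂ))
variable (T : (k : ℕ) → Tor M → (Fin d → Fin (L ^ k)) → Fin (L ^ k) → Fin d → (ℂ →L[ℂ] ℂ))
variable (T' : (k : ℕ) → Tor (fine (L ^ k) M) → (Fin d → Fin L) → Fin L → Fin d → (ℂ →L[ℂ] ℂ))

/-- **THE VECTOR END OF ROAD P2 MODULO THE LEAVES — LANDAU FAMILY** (`G k := landauG δ (R k)`, `G′ k := landauG δ (R′ k)`, `Gm k := KLandau δ (R k)`, `0 < δ`):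
`VariationalVectorEndOfLeaves.towerLimitRate_effV_of_leaves` with its three structural binders (`Gm k` PSD, `G k = qform (Gm k) ∘ unc`, `G (k+1) = Gtr (G′ k)`)
DISCHARGED by §1–§2.  Remaining binders: the COMP DATA identities `hTcomp`∕`hRtr`, one-step `QvL (T′ k)` onto, `0 < a`, the five per-level leaf families of
`vector_pair_bracket_sqrt` DISPLAYED for these functionals (level constants `≤` starred constants, small parameters `δF k`, `ε₁ k`, `δ′ k ≤ c·θ^k`, `0 ≤ θ < 1`).
HONEST: the displayed `hFED`∕`hONE` for `landauG` are NOT the tree's `G′ = 0` curl halves and are NOT expected to hold as displayed for the naive Landau functional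
(NOTE N-ne2leaf01g6-1) — V-GF OPEN; nothing of NE3. [folklore] -/
theorem towerLimitRate_effV_of_leaves_landau {δ : ℝ} (hδ : 0 < δ)
    (hTcomp : ∀ k, T (k + 1) = compL (L ^ k) L M (T k) (T' k)) (hRtr : ∀ k, R (k + 1) = Rtrv (L ^ k) L M (R' k))
    (hsurj₁ : ∀ k, Function.Surjective (QvL L (fine (L ^ k) M) (T' k)))
    {a : ℝ} (ha : 0 < a)
    (Λ CP CR δF ε₁ δ' : ℕ → ℝ) {Λs CPs CRs cδ cε cδ' θ : ℝ}
    (hΛ : ∀ k, 0 ≤ Λ k) (hΛs : ∀ k, Λ k ≤ Λs) (hCP : ∀ k, 0 ≤ CP k) (hCPs : ∀ k, CP k ≤ CPs) (hCR : ∀ k, 0 ≤ CR k) (hCRs : ∀ k, CR k ≤ CRs)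
    (hδF : ∀ k, 0 ≤ δF k) (hε₁ : ∀ k, 0 ≤ ε₁ k) (hδ' : ∀ k, 0 ≤ δ' k) (hθ : 0 ≤ θ) (hθ1 : θ < 1)
    (hδθ : ∀ k, δF k ≤ cδ * θ ^ k) (hεθ : ∀ k, ε₁ k ≤ cε * θ ^ k) (hδ'θ : ∀ k, δ' k ≤ cδ' * θ ^ k)
    {ρV : (k : ℕ) → (Tor (fine (L ^ k) M) → Fin d → ℂ) → ℝ} (hρ0 : ∀ k W, 0 ≤ ρV k W)
    (hUBc : ∀ k (φ : Tor M → Fin d → ℂ), ∃ W, QvL (L ^ k) M (T k) W = φ ∧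
      ScV (L ^ k) M (R k) (landauG (fine (L ^ k) M) δ (R k)) W ≤ Λ k * nsqV M φ)
    (hUBf : ∀ k (φ : Tor M → Fin d → ℂ), ∃ W', QvL (L ^ k) M (T k) (QvL L (fine (L ^ k) M) (T' k) W') = φ ∧
      SfV (L ^ k) L M (R' k) (landauG (fine L (fine (L ^ k) M)) δ (R' k)) W' ≤ Λ k * nsqV M φ)
    (hPc : ∀ k W, qWV (L ^ k) M W ≤ CP k * (ScV (L ^ k) M (R k) (landauG (fine (L ^ k) M) δ (R k)) W + nsqV M (QvL (L ^ k) M (T k) W)))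
    (hPf : ∀ k W', qVV (L ^ k) L M W' ≤ CP k * (SfV (L ^ k) L M (R' k) (landauG (fine L (fine (L ^ k) M)) δ (R' k)) W'
      + nsqV M (QvL (L ^ k) M (T k) (QvL L (fine (L ^ k) M) (T' k) W'))))
    (hFED : ∀ k W', ScV (L ^ k) M (R k) (landauG (fine (L ^ k) M) δ (R k)) (QvL L (fine (L ^ k) M) (T' k) W')
      ≤ (Real.sqrt (SfV (L ^ k) L M (R' k) (landauG (fine L (fine (L ^ k) M)) δ (R' k)) W') + δF k * Real.sqrt (qVV (L ^ k) L M W')) ^ 2)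
    (hONE : ∀ k W, blockSpin (QvL L (fine (L ^ k) M) (T' k)) (SfV (L ^ k) L M (R' k) (landauG (fine L (fine (L ^ k) M)) δ (R' k))) W
      ≤ (Real.sqrt (ScV (L ^ k) M (R k) (landauG (fine (L ^ k) M) δ (R k)) W + ε₁ k * ρV k W) + δ' k * Real.sqrt (qWV (L ^ k) M W)) ^ 2)
    (hREG : ∀ k (φ : Tor M → Fin d → ℂ) W, QvL (L ^ k) M (T k) W = φ →
      (∀ W₂, QvL (L ^ k) M (T k) W₂ = φ →
        ScV (L ^ k) M (R k) (landauG (fine (L ^ k) M) δ (R k)) W ≤ ScV (L ^ k) M (R k) (landauG (fine (L ^ k) M) δ (R k)) W₂) →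
      ρV k W ≤ CR k * (ScV (L ^ k) M (R k) (landauG (fine (L ^ k) M) δ (R k)) W + nsqV M φ)) :
    TowerLimitRate (ι := fun _ => Tor M × Fin d) (fun _ => (1 : Matrix (Tor M × Fin d) (Tor M × Fin d) ℂ)) 1
      (fun k => effV (L ^ k) M (R k) (KLandau (fine (L ^ k) M) δ (R k)) (QmL (L ^ k) M (T k)) a) (eV Λs CPs cδ + ePV Λs CPs CRs cε cδ') θ :=
  towerLimitRate_effV_of_leaves L M R R' (fun k => KLandau (fine (L ^ k) M) δ (R k)) (fun k => landauG (fine (L ^ k) M) δ (R k))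
    (fun k => landauG (fine L (fine (L ^ k) M)) δ (R' k)) T T' (fun k => KLandau_posSemidef (fine (L ^ k) M) hδ.le (R k))
    (fun k W => landauG_eq_qform (fine (L ^ k) M) δ (R k) W) hTcomp hRtr (fun k => landauG_hGtr L M R R' hRtr δ k) hsurj₁ ha Λ CP CR δF ε₁ δ'
    hΛ hΛs hCP hCPs hCR hCRs hδF hε₁ hδ' hθ hθ1 hδθ hεθ hδ'θ hρ0 hUBc hUBf hPc hPf hFED hONE hREG

end Tower

end Summit.QuantumFields.BalabanUV.T4Continuum.VariationalVectorLandauTower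

end
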